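import Literature.NumberTheory.Automorphic.VarmaUnramifiedWeilTraces
import Literature.NumberTheory.Automorphic.AdicCompletionResidueCard
import Literature.NumberTheory.GaloisRepresentations.DecompositionGroupOfCompletion
import HarnessLib

/-!
# Varma 2024, Theorem 1 at the unramified places (trace form) from Corollary 9.3

Topic `Literature/NumberTheory/Automorphic`; a PROOFS sibling of `VarmaUnramifiedWeilTraces`
(theorems only: no definition, no named fact — D-0014/D-0026).

## The result

`Literature.NumberTheory.Automorphic.Varma2024.theorem1_unramified_traces_of_corollary93_unramified`:
the named fact `Varma2024.theorem1_unramified_traces` (Varma, Forum Math. Sigma 12 (2024) e21,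
**Thm. 1** at a place `v ∤ ℓ` where `π_v` is unramified, in trace form: every `σ ∈ Γ_{K_v}` of
Frobenius degree `d` has `tr r(σ) = ∑_j b_j ^ d`, the `b_j` being the predicted arithmetic-Frobenius
eigenvalues) FOLLOWS, in the tree, from the named fact `Varma2024.corollary93_unramified`
(`ReciprocityGLnProofs`: the unramified-place content of Varma's **Cor. 9.3** — every semisimple
`r` with Harris–Lan–Taylor–Thorne's property is unramified at every `v ∤ ℓ` where `π_v` is
unramified, with arithmetic-Frobenius characteristic polynomial `arithFrobPolyOfSatake ι q_v n α`).
This corrects the sentence "neither implies nor is implied in the tree by `corollary93_unramified`"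
of the module docstring of `VarmaUnramifiedWeilTraces`: the implication
`corollary93_unramified → theorem1_unramified_traces` is decomposition-group bookkeeping plus
linear algebra, all of which the tree now has; only the converse (Theorem 1 ⟹ Theorem 2 at an
unramified `π_v`, via the Jacquet–Shalika gap) is the business of the crux line
`Summits/Langlands/…/GaloisRepOfRegularAlgebraic`.  Consequently `theorem1_unramified_traces`
also follows from **lang.S27** (`exists_galoisRep_of_regularAlgebraic`) through
`Varma2024.corollary93_unramified_of_regularAlgebraic` (`ReciprocityGLnUniquenessHolds`, not
imported here to keep the Chebotarev cone out of this file).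

## The argument (Varma, arXiv:1411.2520, proof of Thm. 10.2, p. 24: "Let `𝔉` contain all
elements `σ_v ∈ W_{F_v}` which project to a power of Frobenius …"; Serre, *Abelian `ℓ`-adic
representations*, Ch. I §2.1; Neukirch, *Algebraic Number Theory*, Ch. II §9 Prop. (9.6))

Fix `v ∤ ℓ` with `π_v` unramified of Satake parameter `α`, and let
`P = arithFrobPolyOfSatake ι q_v n α`.  Let `𝔓₀` be the prime of `\bar ℤ_K` above `v` cut out by
the chosen embedding `K̄ → \bar K_v` (`adicCompletionPrime K v`, file
`DecompositionGroupOfCompletion`): its decomposition group is the image of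
`res : Γ_{K_v} → Γ_K`, its inertia group is `res (I_{K_v})`, and `res φ` is an arithmetic Frobenius
at `𝔓₀` iff `φ` is an arithmetic Frobenius of `K_v` (`IsAbsArithFrob`, degree `1`).
1. *A local Frobenius exists*: an arithmetic Frobenius `g ∈ Γ_K` at `𝔓₀` exists
   (`exists_isArithFrobAt_of_mem_primesAbove_holds`, profinite lying-over), lies in `D_{𝔓₀}`,
   hence `g = res φ` with `φ` of degree `1` (`exists_isFrobPow_one`).
2. *Degrees*: `φ ^ d` has degree `d` (`isFrobPow_zpow_of_isFrobPow_one`, from the homomorphism property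
   `IsFrobPow.mul_holds`), so `σ (φ ^ d)⁻¹ ∈ I_{K_v}` for `σ` of degree `d`, and
   `res (σ (φ ^ d)⁻¹) ∈ I_{𝔓₀}`.
3. *Compatibility* (`corollary93_unramified`): `r` kills `I_{𝔓₀}` and `charpoly r(res φ) = P`;
   hence `r(res σ) = r(res φ) ^ d`.
4. *Linear algebra*: for an invertible matrix `M` over an algebraically closed field and `d ∈ ℤ`,
   `tr (M ^ d) = ∑_{b root of charpoly M} b ^ d` (`gl_trace_zpow_eq_sum_roots_zpow`: generalised
   eigenspaces for `d ≥ 0`, as in `LadicLimit.matrix_trace_pow_eq_sum_roots_pow` of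
   `GaloisRepOfLadicLimit` — reproved here rather than importing that file's Chebotarev cone —
   and Cayley–Hamilton, `M⁻¹ = R(M)` with `R(b) = b⁻¹` at every root `b`, for `d < 0`).

## References

* I. Varma, *Local-global compatibility for regular algebraic cuspidal automorphic representations
  when `ℓ ≠ p`*, Forum Math. Sigma 12 (2024) e21, doi:10.1017/fms.2024.7 = arXiv:1411.2520:
  Thm. 1 (p. 2), Cor. 9.3 (p. 32) (= arXiv Thm. 10.2 / Cor. 10.3 and the proof of Thm. 10.2,
  p. 24). [VarmaFMS2024]
* J.-P. Serre, *Abelian ℓ-adic representations and elliptic curves* (1968), Ch. I §2.1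
  (Frobenius elements, decomposition groups). [SerreAbelianLadic1968]
* J. Neukirch, *Algebraic Number Theory* (1999), Ch. II §9, Prop. (9.6). [NeukirchANT1999]
* N. Bourbaki, *Algèbre*, Ch. VII §5 (characteristic roots of powers of an endomorphism).
-/

noncomputable section

open scoped MatrixGroups Matrix NumberField Polynomial
open NumberField IsDedekindDomain Field Polynomial

namespace Literature.NumberTheory.Automorphic

namespace Varma2024

/-! ### Linear algebra: traces of integer powers are power sums of the characteristic roots -/

section LinearAlgebra

open Module Module.End

variable {F : Type*} [Field F]

/-- `tr(f ^ m) = Σ_μ mult_μ(χ_f) · μ ^ m` for an endomorphism of a finite-dimensional vector space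
over an algebraically closed field: `V = ⊕_μ V(μ)` (generalised eigenspaces, Mathlib
`Module.End.iSup_maxGenEigenspace_eq_top`), `f ^ m - μ ^ m` is nilpotent on `V(μ)`, and
`dim V(μ) = mult_μ(χ_f)` (Mathlib `LinearMap.finrank_maxGenEigenspace_eq`).  Same statement and
proof as `LadicLimit.trace_pow_eq_sum_rootMultiplicity` (`GaloisRepOfLadicLimit`), repeated here so
as not to import that file's (Chebotarev) import cone into the cone of Varma's Theorem 1.
Ref: Bourbaki, *Algèbre*, Ch. VII §5 no. 5. [folklore] -/
theorem end_trace_pow_eq_sum_rootMultiplicity {V : Type*} [AddCommGroup V] [Module F V]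
    [IsAlgClosed F] [FiniteDimensional F V] [DecidableEq F] (f : End F V) (m : ℕ) :
    LinearMap.trace F V (f ^ m) =
      ∑ μ ∈ f.charpoly.roots.toFinset, (f.charpoly.rootMultiplicity μ : F) * μ ^ m := by
  have hint : DirectSum.IsInternal f.maxGenEigenspace :=
    DirectSum.isInternal_submodule_of_iSupIndep_of_iSup_eq_top f.independent_maxGenEigenspace
      f.iSup_maxGenEigenspace_eq_top
  have hne : f.charpoly ≠ 0 := f.charpoly_monic.ne_zero
  have hsupp : {μ : F | f.maxGenEigenspace μ ≠ ⊥} = (f.charpoly.roots.toFinset : Set F) := by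
    ext μ
    simp only [Set.mem_setOf_eq, Finset.mem_coe, Multiset.mem_toFinset, mem_roots hne, ne_eq]
    rw [← rootMultiplicity_pos hne, ← LinearMap.finrank_maxGenEigenspace_eq, pos_iff_ne_zero, ne_eq,
      not_iff_not, Submodule.finrank_eq_zero]
  have hfin : {μ : F | f.maxGenEigenspace μ ≠ ⊥}.Finite := by
    rw [hsupp]; exact Finset.finite_toSet _
  have hmaps : ∀ μ : F, Set.MapsTo ⇑(f ^ m) ↑(f.maxGenEigenspace μ) ↑(f.maxGenEigenspace μ) :=
    fun μ => mapsTo_maxGenEigenspace_of_comm (Commute.pow_right (Commute.refl f) m) μ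
  rw [LinearMap.trace_eq_sum_trace_restrict' hint hfin hmaps]
  have hset : hfin.toFinset = f.charpoly.roots.toFinset := by
    rw [← Finset.coe_inj, Set.Finite.coe_toFinset, hsupp]
  rw [hset]
  refine Finset.sum_congr rfl fun μ _ ↦ ?_
  set W := f.maxGenEigenspace μ
  have hW : Set.MapsTo ⇑(f - algebraMap F (End F V) μ) ↑W ↑W :=
    mapsTo_maxGenEigenspace_of_comm (Algebra.mul_sub_algebraMap_commutes f μ) μ
  have hnil : IsNilpotent ((f - algebraMap F (End F V) μ).restrict hW) :=
    isNilpotent_restrict_maxGenEigenspace_sub_algebraMap f μ hW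
  obtain ⟨q, hq⟩ : ∃ q : F[X], (X : F[X]) ^ m - C (μ ^ m) = (X - C μ) * q := by
    have h : (X - C μ) ∣ (X : F[X]) ^ m - C (μ ^ m) := by
      rw [dvd_iff_isRoot]; simp
    exact h
  have hfW : Set.MapsTo ⇑f ↑W ↑W := mapsTo_maxGenEigenspace_of_comm (Commute.refl f) μ
  have e2 : (f - algebraMap F (End F V) μ).restrict hW = aeval (f.restrict hfW) (X - C μ) := by
    rw [map_sub, aeval_X, aeval_C]
    ext ⟨v, hv⟩
    simp [LinearMap.restrict_apply, Module.algebraMap_end_apply]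
  have key : (f ^ m).restrict (hmaps μ) - algebraMap F (Module.End F ↥W) (μ ^ m) =
      (f - algebraMap F (End F V) μ).restrict hW * aeval (f.restrict hfW) q := by
    have e1 : (f ^ m).restrict (hmaps μ) = aeval (f.restrict hfW) ((X : F[X]) ^ m) := by
      rw [map_pow, aeval_X, Module.End.pow_restrict]
    rw [e1, e2, ← map_mul, ← hq, map_sub, aeval_C]
  have hcomm : Commute ((f - algebraMap F (End F V) μ).restrict hW) (aeval (f.restrict hfW) q) := by
    rw [e2]
    exact (Commute.all (X - C μ) q).map (aeval (f.restrict hfW))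
  have hnil2 : IsNilpotent ((f ^ m).restrict (hmaps μ) - algebraMap F (Module.End F ↥W) (μ ^ m)) := by
    rw [key]; exact hcomm.isNilpotent_mul_right hnil
  have htr0 : LinearMap.trace F ↥W
      ((f ^ m).restrict (hmaps μ) - algebraMap F (Module.End F ↥W) (μ ^ m)) = 0 :=
    (LinearMap.isNilpotent_trace_of_isNilpotent hnil2).eq_zero
  rw [map_sub, sub_eq_zero] at htr0
  rw [htr0, Module.algebraMap_end_eq_smul_id, map_smul, LinearMap.trace_id, smul_eq_mul, mul_comm,
    LinearMap.finrank_maxGenEigenspace_eq]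

variable {ι : Type*} [Fintype ι] [DecidableEq ι]

/-- **Matrix form**: `tr(A ^ m) = Σ_{b root of χ_A, with multiplicity} b ^ m` for a square matrix
over an algebraically closed field (cf. `LadicLimit.matrix_trace_pow_eq_sum_roots_pow`).
Ref: Bourbaki, *Algèbre*, Ch. VII §5 no. 5. [folklore] -/
theorem matrix_trace_pow_eq_sum_roots_pow [IsAlgClosed F] (A : Matrix ι ι F) (m : ℕ) :
    (A ^ m).trace = (A.charpoly.roots.map (· ^ m)).sum := by
  classical
  have h1 := end_trace_pow_eq_sum_rootMultiplicity (Matrix.toLin' A) m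
  rw [← Matrix.toLin'_pow, Matrix.trace_toLin'_eq, Matrix.charpoly_toLin'] at h1
  rw [h1, Finset.sum_multiset_map_count]
  refine Finset.sum_congr rfl fun μ _ => ?_
  rw [count_roots, nsmul_eq_mul]

/-- **Traces of polynomials in a matrix**: `tr R(A) = Σ_{b root of χ_A} R(b)` over an
algebraically closed field (linearity from `matrix_trace_pow_eq_sum_roots_pow`).
Ref: Bourbaki, *Algèbre*, Ch. VII §5 no. 5. [folklore] -/
theorem matrix_trace_aeval_eq_sum_roots [IsAlgClosed F] (A : Matrix ι ι F) (R : F[X]) :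
    (aeval A R).trace = (A.charpoly.roots.map fun b => R.eval b).sum := by
  induction R using Polynomial.induction_on' with
  | add p q hp hq =>
    simp only [map_add, Matrix.trace_add, hp, hq, eval_add, Multiset.sum_map_add]
  | monomial k a =>
    rw [aeval_monomial, Algebra.algebraMap_eq_smul_one, smul_mul_assoc, one_mul, Matrix.trace_smul,
      smul_eq_mul, matrix_trace_pow_eq_sum_roots_pow, ← Multiset.sum_map_mul_left]
    refine congrArg _ (Multiset.map_congr rfl fun b _ => ?_)
    rw [eval_monomial]

omit [Fintype ι] [DecidableEq ι] in
/-- At a root `b` of a polynomial `P` with non-zero constant term `c`, the polynomial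
`P.divX * C (-c⁻¹)` (where `P = X * P.divX + c`) takes the value `b⁻¹`. [folklore] -/
theorem eval_divX_mul_C_of_isRoot {P : F[X]} {b : F} (hb : P.IsRoot b) (h0 : P.coeff 0 ≠ 0) :
    (P.divX * C (-(P.coeff 0)⁻¹)).eval b = b⁻¹ := by
  have hb0 : b ≠ 0 := by
    rintro rfl
    apply h0
    rw [coeff_zero_eq_eval_zero]
    exact hb
  have h1 : b * P.divX.eval b + P.coeff 0 = 0 := by
    have := congrArg (eval b) (X_mul_divX_add P)
    rw [eval_add, eval_mul, eval_X, eval_C] at this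
    rw [this]
    exact hb
  have hd : P.divX.eval b = -(P.coeff 0) * b⁻¹ := by
    field_simp
    linear_combination h1
  rw [eval_mul, eval_C, hd]
  field_simp

/-- **Cayley–Hamilton: the inverse of an invertible matrix is a polynomial in the matrix**,
`A⁻¹ = A.charpoly.divX (A) · (-c⁻¹)` where `c = χ_A(0) ≠ 0` (`X · χ_A.divX + c = χ_A` and
`χ_A(A) = 0`, Mathlib `Matrix.aeval_self_charpoly`).
Ref: Bourbaki, *Algèbre*, Ch. III §8 no. 11 (Cayley–Hamilton). [folklore] -/
theorem matrix_inv_eq_aeval_divX_charpoly (A : Matrix ι ι F) (h0 : A.charpoly.coeff 0 ≠ 0) :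
    A⁻¹ = aeval A (A.charpoly.divX * C (-(A.charpoly.coeff 0)⁻¹)) := by
  apply Matrix.inv_eq_right_inv
  have key : A * aeval A A.charpoly.divX = algebraMap F _ (-(A.charpoly.coeff 0)) := by
    have h1 := congrArg (aeval A) (X_mul_divX_add A.charpoly)
    rw [map_add, map_mul, aeval_X, aeval_C, Matrix.aeval_self_charpoly] at h1
    rw [map_neg]
    exact eq_neg_of_add_eq_zero_left h1
  rw [map_mul, aeval_C, ← mul_assoc, key, ← map_mul, neg_mul_neg, mul_inv_cancel₀ h0, map_one]

/-- **Traces of integer powers of an invertible matrix are power sums of its characteristic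
roots**: for `u ∈ GL_ι(F)`, `F` algebraically closed, and `d ∈ ℤ`,
`tr (u ^ d) = Σ_{b root of χ_u, with multiplicity} b ^ d` (`d ≥ 0`:
`matrix_trace_pow_eq_sum_roots_pow`; `d < 0`: `u⁻¹ = R(u)` by Cayley–Hamilton with `R(b) = b⁻¹`
at every characteristic root `b`, and `matrix_trace_aeval_eq_sum_roots`).
Ref: Bourbaki, *Algèbre*, Ch. VII §5 no. 5. [folklore] -/
theorem gl_trace_zpow_eq_sum_roots_zpow [IsAlgClosed F] (u : GL ι F) (d : ℤ) :
    ((u ^ d : GL ι F) : Matrix ι ι F).trace =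
      ((u : Matrix ι ι F).charpoly.roots.map (· ^ d)).sum := by
  have h0 : (u : Matrix ι ι F).charpoly.coeff 0 ≠ 0 := by
    intro h
    have hdet : (u : Matrix ι ι F).det = 0 := by
      rw [Matrix.det_eq_sign_charpoly_coeff, h, mul_zero]
    exact (Matrix.isUnits_det_units u).ne_zero hdet
  have hne : (u : Matrix ι ι F).charpoly ≠ 0 := (Matrix.charpoly_monic _).ne_zero
  cases d with
  | ofNat m =>
    rw [Int.ofNat_eq_natCast, zpow_natCast, Units.val_pow_eq_pow_val, matrix_trace_pow_eq_sum_roots_pow]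
    refine congrArg _ (Multiset.map_congr rfl fun b _ => ?_)
    rw [zpow_natCast]
  | negSucc m =>
    rw [zpow_negSucc, Matrix.coe_units_inv, Units.val_pow_eq_pow_val, ← Matrix.inv_pow',
      matrix_inv_eq_aeval_divX_charpoly _ h0, ← map_pow, matrix_trace_aeval_eq_sum_roots]
    refine congrArg _ (Multiset.map_congr rfl fun b hb => ?_)
    rw [eval_pow, eval_divX_mul_C_of_isRoot (isRoot_of_mem_roots hb) h0, zpow_negSucc, inv_pow]

end LinearAlgebra

/-! ### Frobenius powers of the local Galois group and the decomposition group at `v` -/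

section Frobenius

open Literature.NumberTheory.GaloisRepresentations
open Literature.NumberTheory.GaloisRepresentations.IsNonarchimedeanLocalField (residueFieldCard)

/-- **Powers of an arithmetic Frobenius**: if `φ ∈ Γ_F` has Frobenius degree `1` then `φ ^ d` has
degree `d` for every `d ∈ ℤ` (`deg : W_F → ℤ` is a homomorphism, `IsFrobPow.mul_holds`).
Ref: Tate, *Number theoretic background* (Corvallis 1979), §1.4, (1.4.1)–(1.4.4). [folklore] -/
theorem isFrobPow_zpow_of_isFrobPow_one {F : Type*} [Field F] [ValuativeRel F] [TopologicalSpace F]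
    [IsNonarchimedeanLocalField F] {φ : absoluteGaloisGroup F} (hφ : IsFrobPow φ 1) (d : ℤ) :
    IsFrobPow (φ ^ d) d := by
  induction d using Int.induction_on with
  | zero => simpa using (IsFrobPow.one : IsFrobPow (1 : absoluteGaloisGroup F) 0)
  | succ k ih =>
    rw [zpow_add_one]
    exact IsFrobPow.mul_holds ih hφ
  | pred k ih =>
    rw [zpow_sub_one, sub_eq_add_neg]
    exact IsFrobPow.mul_holds ih (IsFrobPow.inv hφ)

variable (K : Type) [Field K] [NumberField K] (v : HeightOneSpectrum (𝓞 K))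

/-- **A local arithmetic Frobenius exists**: some `φ ∈ Γ_{K_v}` has Frobenius degree `1`.  An
arithmetic Frobenius `g ∈ Γ_K` at the prime `𝔓₀ = adicCompletionPrime K v` exists
(`exists_isArithFrobAt_of_mem_primesAbove_holds`) and lies in the decomposition group
`D_{𝔓₀} = res (Γ_{K_v})` (`decompositionSubgroup_adicCompletionPrime_eq_range`), so `g = res φ`,
and `φ` is an arithmetic Frobenius of `K_v` (`isArithFrobAt_absGaloisRestrict_adicCompletionPrime_iff`).
Ref: Serre, *Abelian ℓ-adic representations* (1968), Ch. I §2.1; Neukirch, *Algebraic Number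
Theory*, Ch. II §9, Prop. (9.6). [cite: NeukirchANT1999, Ch. II §9 Prop. (9.6)] -/
theorem exists_isFrobPow_one :
    ∃ φ : absoluteGaloisGroup (v.adicCompletion K), IsFrobPow φ 1 := by
  obtain ⟨g, hg⟩ := HeightOneSpectrum.exists_isArithFrobAt_of_mem_primesAbove_holds
    (adicCompletionPrime_mem_primesAbove K v)
  have hgD : g ∈ (adicCompletionPrime K v).decompositionSubgroup (absoluteGaloisGroup K) :=
    hg.mem_stabilizer
  rw [decompositionSubgroup_adicCompletionPrime_eq_range] at hgD
  obtain ⟨φ, hφ⟩ := hgD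
  -- `q_{K_v} = #(𝓞 K ⧸ v)` (`residueFieldCard_adicCompletion_eq`), the hypothesis `hq` of the
  -- Frobenius dictionary `isArithFrobAt_absGaloisRestrict_adicCompletionPrime_iff`
  have hq : residueFieldCard (v.adicCompletion K) = Nat.card (𝓞 K ⧸ v.asIdeal) :=
    (residueFieldCard_adicCompletion_eq K v).trans v.residueCard_eq_card_quotient
  refine ⟨φ, isFrobPow_one_iff_isAbsArithFrob_holds.mpr ?_⟩
  rw [← isArithFrobAt_absGaloisRestrict_adicCompletionPrime_iff K v hq φ]
  have e : absGaloisRestrict K (v.adicCompletion K) φ = g := hφ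
  rw [e]
  exact hg

variable {K v}

/-- **Elements of Frobenius degree `d` versus the `d`-th power of a Frobenius**: if `σ ∈ Γ_{K_v}`
has degree `d` and `φ` has degree `1`, then `res σ = res (σ (φ ^ d)⁻¹) · (res φ) ^ d` with
`res (σ (φ ^ d)⁻¹)` in the inertia group of `𝔓₀ = adicCompletionPrime K v`
(`I_{𝔓₀} = res (I_{K_v})`, `inertia_adicCompletionPrime_eq_map_absInertia`).
Ref: Tate, Corvallis 1979, (1.4.1); Neukirch, *Algebraic Number Theory*, Ch. II §9, Prop. (9.6).
[cite: NeukirchANT1999, Ch. II §9 Prop. (9.6)] -/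
theorem absGaloisRestrict_mul_zpow_inv_mem_inertia {σ φ : absoluteGaloisGroup (v.adicCompletion K)}
    {d : ℤ} (hσ : IsFrobPow σ d) (hφ : IsFrobPow φ 1) :
    absGaloisRestrict K (v.adicCompletion K) (σ * (φ ^ d)⁻¹) ∈
      (adicCompletionPrime K v).inertia (absoluteGaloisGroup K) := by
  have hι : σ * (φ ^ d)⁻¹ ∈ absInertia (v.adicCompletion K) := by
    rw [← isFrobPow_zero_iff_mem_absInertia]
    have h := IsFrobPow.mul_holds hσ (IsFrobPow.inv (isFrobPow_zpow_of_isFrobPow_one hφ d))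
    rwa [add_neg_cancel] at h
  rw [inertia_adicCompletionPrime_eq_map_absInertia]
  exact ⟨_, hι, rfl⟩

end Frobenius

/-! ### The reduction -/

open Literature.NumberTheory.GaloisRepresentations
open Literature.NumberTheory.GaloisRepresentations.IsNonarchimedeanLocalField (residueFieldCard)

/-- **Varma 2024, Thm. 1 at the unramified places (trace form) from Cor. 9.3 (unramified places).**
`corollary93_unramified → theorem1_unramified_traces`: at `v ∤ ℓ` with `π_v` unramified of Satake
parameter `α`, Cor. 9.3 makes `r` unramified at `v` with `charpoly r(Frob) = P`,
`P = arithFrobPolyOfSatake ι q_v n α`, at every arithmetic Frobenius at every prime above `v`; for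
`σ ∈ Γ_{K_v}` of Frobenius degree `d`, `res σ ≡ (res φ) ^ d` modulo the inertia group of the prime
`𝔓₀` above `v` cut out by `K̄ → \bar K_v`, `φ` an arithmetic Frobenius of `K_v`
(`exists_isFrobPow_one`, `absGaloisRestrict_mul_zpow_inv_mem_inertia`), so
`r(res σ) = r(res φ) ^ d` and `tr r(res σ) = ∑_{b root of P} b ^ d`
(`gl_trace_zpow_eq_sum_roots_zpow`).  This is the step "for all `σ_v ∈ W_{F_v}` which project to a
power of Frobenius" of Varma's proof of (arXiv) Thm. 10.2, run backwards from the printed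
conclusion. [cite: VarmaFMS2024, Thm. 1 (p. 2) and Cor. 9.3 (p. 32); arXiv:1411.2520 proof of Thm. 10.2 (p. 24)]
[cite: NeukirchANT1999, Ch. II §9 Prop. (9.6)] -/
theorem theorem1_unramified_traces_of_corollary93_unramified (hV : corollary93_unramified) :
    theorem1_unramified_traces := by
  intro n K _ _ hcpt hK π hπ ℓ _ ι r hr hc v hv α hα σ d hσ
  obtain ⟨hunr, hfrob⟩ := hV hcpt hK π hπ ℓ ι r hr hc v hv α hα
  have h𝔓 := adicCompletionPrime_mem_primesAbove K v
  -- a local arithmetic Frobenius `φ`; `res φ` is a global one at `𝔓₀`, so `charpoly r(res φ) = P`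
  obtain ⟨φ, hφ⟩ := exists_isFrobPow_one K v
  have hq : residueFieldCard (v.adicCompletion K) = Nat.card (𝓞 K ⧸ v.asIdeal) :=
    (residueFieldCard_adicCompletion_eq K v).trans v.residueCard_eq_card_quotient
  have hφg : IsArithFrobAt (𝓞 K) (absGaloisRestrict K (v.adicCompletion K) φ)
      (adicCompletionPrime K v) :=
    (isArithFrobAt_absGaloisRestrict_adicCompletionPrime_iff K v hq φ).mpr
      (isFrobPow_one_iff_isAbsArithFrob_holds.mp hφ)
  have hP : ((r (absGaloisRestrict K (v.adicCompletion K) φ) : GL (Fin n) (PadicAlgCl ℓ)) :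
      Matrix (Fin n) (Fin n) (PadicAlgCl ℓ)).charpoly = arithFrobPolyOfSatake ι v.residueCard n α :=
    hfrob _ h𝔓 _ hφg
  -- `r` kills `res (σ (φ ^ d)⁻¹) ∈ I_{𝔓₀}`
  have hone : r (absGaloisRestrict K (v.adicCompletion K) (σ * (φ ^ d)⁻¹)) = 1 :=
    hunr _ h𝔓 _ (absGaloisRestrict_mul_zpow_inv_mem_inertia hσ hφ)
  -- hence `r(res σ) = r(res φ) ^ d`
  have hστ : (r.toLocal v) σ = r (absGaloisRestrict K (v.adicCompletion K) φ) ^ d := by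
    rw [FramedGaloisRep.toLocal_apply]
    calc r (absGaloisRestrict K (v.adicCompletion K) σ)
        = r (absGaloisRestrict K (v.adicCompletion K) (σ * (φ ^ d)⁻¹ * φ ^ d)) := by
          rw [inv_mul_cancel_right]
      _ = r (absGaloisRestrict K (v.adicCompletion K) (σ * (φ ^ d)⁻¹)) *
            r (absGaloisRestrict K (v.adicCompletion K) φ) ^ d := by
          rw [map_mul (absGaloisRestrict K (v.adicCompletion K)) _ (φ ^ d), map_mul r, map_zpow,
            map_zpow]
      _ = r (absGaloisRestrict K (v.adicCompletion K) φ) ^ d := by rw [hone, one_mul]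
  rw [hστ, gl_trace_zpow_eq_sum_roots_zpow, hP]

end Varma2024

end Literature.NumberTheory.Automorphic

end
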